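import Literature.Geometry.Lorentzian.KerrFarEnergyComparison
import Literature.Geometry.Lorentzian.KerrSchildKillingEnergy
import Literature.Geometry.Lorentzian.KerrSchildMultiplierCoercivity
import Literature.Geometry.Lorentzian.KerrSchildMultiplierDEC

/-!
# Route ClusterCompleteness — crux `AdiabaticMultiKerrILED`, line `Sketch`:
# the `T`-energy through a tilted lab leaf

Helper file for the crux `stmt-FinalStateConjecture-14310` (line `Sketch`), stubs
`tEnergy_leafFlux_coercive` and `abs_sum_multiplierCurrent_timeField_mul_le`: the two-sided
comparison "`T`-energy density through a tilted lab leaf `∼ ∑_μ (∂_μ w)²`" for coefficient fields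
of Kerr–Schild form `G = η⁻¹ − φ l ⊗ l` (`KerrSchild.inverseMetric φ l`, `l` Minkowski-null with
`η(l, ∂₀) = 1`, i.e. `l⁰ = −1`, `|l⃗| = 1`) and the Killing multiplier `T = ∂₀`
(`KerrSchild.timeField`), uniformly in the point:

* `neg_sum_multiplierCurrent_timeField_mul_eq` — the flux `−∑_μ (J^T)^μ n_μ` through a conormal
  `n = (1, n⃗)` written out as a polynomial in `(φ, l⃗, n⃗, ∂w)`;
* `tEnergy_leafFlux_coercive` — off the ergoregion margin (`0 ≤ φ ≤ φ₀ < 1`) and for leaves of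
  slope `≤ ½` (`∑ nᵢ² ≤ ¼`): `c ∑_μ (∂_μ w)² ≤ −∑_μ (J^T)^μ n_μ` with `c = (1 − φ₀)/16`;
* `abs_sum_multiplierCurrent_timeField_mul_le` — for `0 ≤ φ ≤ Φ` and slope `≤ 1`:
  `|∑_μ (J^T)^μ n_μ| ≤ 4 (1 + Φ) ∑_μ (∂_μ w)²`.

Everything is pointwise algebra (Cauchy–Schwarz in `ℝ³`, `Kerr.sq_dot_le_three`, and
completing squares); the flat-leaf case `n⃗ = 0` is `KerrSchild.Background.tEnergyDensity_ge` /
`…_le` of `KerrSchildKillingEnergy.lean`, the exact-Kerr analogue with margins on both `φ` and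
the slope is `Kerr.fluxQuad_kerrSchild_bounds` of `KerrFarEnergyComparison.lean`, and the sign
alone is the dominant energy condition of `KerrSchildMultiplierDEC.lean`.
Dafermos–Rodnianski–Shlapentokh-Rothman arXiv:1402.7034, §3.1 (`J^N_μ n^μ ∼ ∑ (∂ψ)²`).
[folklore]
-/

noncomputable section

-- the doubled `FinalStateConjecture.FinalStateConjecture` path component trips dupNamespace
set_option linter.dupNamespace false

open scoped BigOperators
open Literature.Geometry.Lorentzian

namespace Summit.FinalStateConjecture.FinalStateConjecture.Theorems

/-! ### Algebra in `ℝ³` -/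

/-- **Cauchy–Schwarz orthogonally to a unit vector.** For `|l⃗| = 1`,
`(n⃗·p⃗ − (l⃗·p⃗)(l⃗·n⃗))² ≤ (|n⃗|² − (l⃗·n⃗)²)(|p⃗|² − (l⃗·p⃗)²)`: Cauchy–Schwarz for the
components of `n⃗`, `p⃗` orthogonal to `l⃗`; equivalently the Gram determinant of `(l⃗, n⃗, p⃗)`
is the square of their triple product. [folklore] -/
theorem tEnergyLeaf_gram_three (l₁ l₂ l₃ n₁ n₂ n₃ p₁ p₂ p₃ : ℝ)
    (hL : l₁ ^ 2 + l₂ ^ 2 + l₃ ^ 2 = 1) :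
    (n₁ * p₁ + n₂ * p₂ + n₃ * p₃ -
        (l₁ * p₁ + l₂ * p₂ + l₃ * p₃) * (l₁ * n₁ + l₂ * n₂ + l₃ * n₃)) ^ 2 ≤
      (n₁ ^ 2 + n₂ ^ 2 + n₃ ^ 2 - (l₁ * n₁ + l₂ * n₂ + l₃ * n₃) ^ 2) *
        (p₁ ^ 2 + p₂ ^ 2 + p₃ ^ 2 - (l₁ * p₁ + l₂ * p₂ + l₃ * p₃) ^ 2) := by
  -- the Gram determinant of `(l⃗, n⃗, p⃗)` (= the squared triple product) minus the target
  -- difference is `(1 − |l⃗|²)(|n⃗|²|p⃗|² − (n⃗·p⃗)²) = 0`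
  have hLX : (1 - (l₁ ^ 2 + l₂ ^ 2 + l₃ ^ 2)) *
      ((n₁ ^ 2 + n₂ ^ 2 + n₃ ^ 2) * (p₁ ^ 2 + p₂ ^ 2 + p₃ ^ 2) -
        (n₁ * p₁ + n₂ * p₂ + n₃ * p₃) ^ 2) = 0 := by
    rw [hL, sub_self, zero_mul]
  nlinarith [hLX, sq_nonneg (l₁ * (n₂ * p₃ - n₃ * p₂) + l₂ * (n₃ * p₁ - n₁ * p₃) +
    l₃ * (n₁ * p₂ - n₂ * p₁))]

/-! ### The flux polynomial -/

/-- **The `T`-energy flux through a conormal `n = (1, n⃗)`, explicitly.** For the Kerr–Schild-form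
coefficient field `G = η⁻¹ − φ l ⊗ l` with `l⁰ = −1` and the multiplier `T = ∂₀`, writing
`p_μ = ∂_μ w`, `a = l⃗·p⃗`, `b = l⃗·n⃗`:
`−∑_μ (J^T)^μ n_μ = ½(1 + φ) p₀² + ½|p⃗|² − (n⃗·p⃗) p₀ − φ b p₀² + φ a b p₀ − ½ φ a²`
(for `n⃗ = 0` this is `KerrSchild.Background.tEnergyDensity_eq`). [folklore] -/
theorem neg_sum_multiplierCurrent_timeField_mul_eq (φ : E4 → ℝ) (l : E4 → E4) (w : E4 → ℝ)
    (x : E4) (n : Fin 4 → ℝ) (hl0 : l x 0 = -1) (hn0 : n 0 = 1) :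
    -∑ μ, KerrSchild.multiplierCurrent (KerrSchild.inverseMetric φ l) KerrSchild.timeField w x μ *
        n μ =
      2⁻¹ * (1 + φ x) * fderiv ℝ w x (E4.basisVector 0) ^ 2 +
        2⁻¹ * (fderiv ℝ w x (E4.basisVector 1) ^ 2 + fderiv ℝ w x (E4.basisVector 2) ^ 2 +
          fderiv ℝ w x (E4.basisVector 3) ^ 2) -
        (n 1 * fderiv ℝ w x (E4.basisVector 1) + n 2 * fderiv ℝ w x (E4.basisVector 2) +
          n 3 * fderiv ℝ w x (E4.basisVector 3)) * fderiv ℝ w x (E4.basisVector 0) -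
        φ x * (l x 1 * n 1 + l x 2 * n 2 + l x 3 * n 3) * fderiv ℝ w x (E4.basisVector 0) ^ 2 +
        φ x * (l x 1 * fderiv ℝ w x (E4.basisVector 1) + l x 2 * fderiv ℝ w x (E4.basisVector 2) +
            l x 3 * fderiv ℝ w x (E4.basisVector 3)) * (l x 1 * n 1 + l x 2 * n 2 + l x 3 * n 3) *
          fderiv ℝ w x (E4.basisVector 0) -
        2⁻¹ * φ x * (l x 1 * fderiv ℝ w x (E4.basisVector 1) +
          l x 2 * fderiv ℝ w x (E4.basisVector 2) +
          l x 3 * fderiv ℝ w x (E4.basisVector 3)) ^ 2 := by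
  obtain ⟨p, hp⟩ : ∃ p : Fin 4 → ℝ, ∀ β, fderiv ℝ w x (E4.basisVector β) = p β := ⟨_, fun _ ↦ rfl⟩
  simp only [KerrSchild.multiplierCurrent, KerrSchild.inverseMetric, KerrSchild.timeField,
    Kerr.etaComp, hp, hl0, hn0, Fin.sum_univ_four, Fin.isValue]
  simp only [show (1 : Fin 4) ≠ 0 from by decide, show (2 : Fin 4) ≠ 0 from by decide,
    show (3 : Fin 4) ≠ 0 from by decide, show (0 : Fin 4) ≠ 1 from by decide,
    show (0 : Fin 4) ≠ 2 from by decide, show (0 : Fin 4) ≠ 3 from by decide,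
    show (1 : Fin 4) ≠ 2 from by decide, show (1 : Fin 4) ≠ 3 from by decide,
    show (2 : Fin 4) ≠ 1 from by decide, show (2 : Fin 4) ≠ 3 from by decide,
    show (3 : Fin 4) ≠ 1 from by decide, show (3 : Fin 4) ≠ 2 from by decide,
    if_true, if_false]
  ring

/-- **Coercivity of the flux polynomial**: for `0 ≤ f ≤ φ₀ < 1`, `|l⃗| = 1` and `|n⃗|² ≤ ¼`,
`(1 − φ₀)/16 · ∑_μ p_μ² ≤ ½(1 + f) p₀² + ½|p⃗|² − (n⃗·p⃗) p₀ − f b p₀² + f a b p₀ − ½ f a²`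
(`a = l⃗·p⃗`, `b = l⃗·n⃗`). Proof: with `q⃗ = p⃗ − a l⃗`, `m⃗ = n⃗ − b l⃗` the right side is
`½(1 − f)(a − b p₀)² + ½(1 − b² + f(1 − b)²) p₀² + ½|q⃗|² − (m⃗·q⃗) p₀`, and
`|m⃗·q⃗| ≤ ½|q⃗|` … completing squares. [folklore] -/
theorem tEnergyLeaf_fluxPoly_coercive {φ₀ f l₁ l₂ l₃ n₁ n₂ n₃ : ℝ} (p₀ p₁ p₂ p₃ : ℝ)
    (hf0 : 0 ≤ f) (hf1 : f ≤ φ₀) (hφ₀ : φ₀ < 1) (hL : l₁ ^ 2 + l₂ ^ 2 + l₃ ^ 2 = 1)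
    (hN : n₁ ^ 2 + n₂ ^ 2 + n₃ ^ 2 ≤ 4⁻¹) :
    (1 - φ₀) / 16 * (p₀ ^ 2 + p₁ ^ 2 + p₂ ^ 2 + p₃ ^ 2) ≤
      2⁻¹ * (1 + f) * p₀ ^ 2 + 2⁻¹ * (p₁ ^ 2 + p₂ ^ 2 + p₃ ^ 2) -
        (n₁ * p₁ + n₂ * p₂ + n₃ * p₃) * p₀ - f * (l₁ * n₁ + l₂ * n₂ + l₃ * n₃) * p₀ ^ 2 +
        f * (l₁ * p₁ + l₂ * p₂ + l₃ * p₃) * (l₁ * n₁ + l₂ * n₂ + l₃ * n₃) * p₀ -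
        2⁻¹ * f * (l₁ * p₁ + l₂ * p₂ + l₃ * p₃) ^ 2 := by
  -- Cauchy–Schwarz facts (before naming the atoms)
  have haP : (l₁ * p₁ + l₂ * p₂ + l₃ * p₃) ^ 2 ≤ p₁ ^ 2 + p₂ ^ 2 + p₃ ^ 2 := by
    have h := Kerr.sq_dot_le_three l₁ l₂ l₃ p₁ p₂ p₃
    rwa [hL, one_mul] at h
  have hbN : (l₁ * n₁ + l₂ * n₂ + l₃ * n₃) ^ 2 ≤ n₁ ^ 2 + n₂ ^ 2 + n₃ ^ 2 := by
    have h := Kerr.sq_dot_le_three l₁ l₂ l₃ n₁ n₂ n₃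
    rwa [hL, one_mul] at h
  have hgram := tEnergyLeaf_gram_three l₁ l₂ l₃ n₁ n₂ n₃ p₁ p₂ p₃ hL
  have hsplit : (1 - φ₀) / 16 * (p₀ ^ 2 + p₁ ^ 2 + p₂ ^ 2 + p₃ ^ 2) =
      (1 - φ₀) / 16 * p₀ ^ 2 + (1 - φ₀) / 16 * (p₁ ^ 2 + p₂ ^ 2 + p₃ ^ 2) := by ring
  rw [hsplit]
  -- name the atoms `a = l⃗·p⃗`, `b = l⃗·n⃗`, `d = n⃗·p⃗`, `P = |p⃗|²`, `N = |n⃗|²`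
  revert hN haP hbN hgram
  generalize l₁ * p₁ + l₂ * p₂ + l₃ * p₃ = a
  generalize l₁ * n₁ + l₂ * n₂ + l₃ * n₃ = b
  generalize n₁ * p₁ + n₂ * p₂ + n₃ * p₃ = d
  generalize p₁ ^ 2 + p₂ ^ 2 + p₃ ^ 2 = P
  generalize n₁ ^ 2 + n₂ ^ 2 + n₃ ^ 2 = N
  intro hN haP hbN hgram
  -- the reduced inequalities
  have hQ0 : 0 ≤ P - a ^ 2 := sub_nonneg.2 haP
  have hb4 : b ^ 2 ≤ 4⁻¹ := hbN.trans hN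
  have hm4 : (d - a * b) ^ 2 ≤ (4⁻¹ - b ^ 2) * (P - a ^ 2) :=
    hgram.trans (by nlinarith [mul_nonneg (sub_nonneg.2 hN) hQ0])
  have hφ₀0 : 0 ≤ φ₀ := hf0.trans hf1
  nlinarith [mul_nonneg (sub_nonneg.2 (hf1.trans hφ₀.le)) (sq_nonneg (a - 2 * b * p₀)),
    sq_nonneg (d - a * b - p₀ / 3), hm4, mul_nonneg (sq_nonneg b) hQ0,
    mul_nonneg (mul_nonneg hf0 (sq_nonneg (1 - b))) (sq_nonneg p₀),
    mul_nonneg (mul_nonneg (sub_nonneg.2 (hf1.trans hφ₀.le)) (sub_nonneg.2 hb4)) (sq_nonneg p₀),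
    mul_nonneg (sub_nonneg.2 hb4) (sq_nonneg p₀),
    mul_nonneg (sub_nonneg.2 hf1) (sq_nonneg a), mul_nonneg (sub_nonneg.2 hφ₀.le) (sq_nonneg a),
    mul_nonneg hf0 (sq_nonneg p₀), mul_nonneg hφ₀0 (sq_nonneg p₀), mul_nonneg hφ₀0 hQ0, hQ0,
    sq_nonneg p₀]

/-- **Boundedness of the flux polynomial**: for `0 ≤ f ≤ Φ`, `|l⃗| = 1` and `|n⃗|² ≤ 1`,
`|½(1 + f) p₀² + ½|p⃗|² − (n⃗·p⃗) p₀ − f b p₀² + f a b p₀ − ½ f a²| ≤ 4(1 + Φ) ∑_μ p_μ²`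
(`a = l⃗·p⃗`, `b = l⃗·n⃗`; `|ab| ≤ ½(a² + b²)` throughout). [folklore] -/
theorem tEnergyLeaf_fluxPoly_abs_le {Φ f l₁ l₂ l₃ n₁ n₂ n₃ : ℝ} (p₀ p₁ p₂ p₃ : ℝ)
    (hf0 : 0 ≤ f) (hf1 : f ≤ Φ) (hL : l₁ ^ 2 + l₂ ^ 2 + l₃ ^ 2 = 1)
    (hN : n₁ ^ 2 + n₂ ^ 2 + n₃ ^ 2 ≤ 1) :
    |2⁻¹ * (1 + f) * p₀ ^ 2 + 2⁻¹ * (p₁ ^ 2 + p₂ ^ 2 + p₃ ^ 2) -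
        (n₁ * p₁ + n₂ * p₂ + n₃ * p₃) * p₀ - f * (l₁ * n₁ + l₂ * n₂ + l₃ * n₃) * p₀ ^ 2 +
        f * (l₁ * p₁ + l₂ * p₂ + l₃ * p₃) * (l₁ * n₁ + l₂ * n₂ + l₃ * n₃) * p₀ -
        2⁻¹ * f * (l₁ * p₁ + l₂ * p₂ + l₃ * p₃) ^ 2| ≤
      4 * (1 + Φ) * (p₀ ^ 2 + p₁ ^ 2 + p₂ ^ 2 + p₃ ^ 2) := by
  -- Cauchy–Schwarz facts (before naming the atoms)
  have haP : (l₁ * p₁ + l₂ * p₂ + l₃ * p₃) ^ 2 ≤ p₁ ^ 2 + p₂ ^ 2 + p₃ ^ 2 := by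
    have h := Kerr.sq_dot_le_three l₁ l₂ l₃ p₁ p₂ p₃
    rwa [hL, one_mul] at h
  have hbN : (l₁ * n₁ + l₂ * n₂ + l₃ * n₃) ^ 2 ≤ n₁ ^ 2 + n₂ ^ 2 + n₃ ^ 2 := by
    have h := Kerr.sq_dot_le_three l₁ l₂ l₃ n₁ n₂ n₃
    rwa [hL, one_mul] at h
  have hdNP := Kerr.sq_dot_le_three n₁ n₂ n₃ p₁ p₂ p₃
  have hP0 : 0 ≤ p₁ ^ 2 + p₂ ^ 2 + p₃ ^ 2 := by positivity
  have hsplit : 4 * (1 + Φ) * (p₀ ^ 2 + p₁ ^ 2 + p₂ ^ 2 + p₃ ^ 2) =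
      4 * (1 + Φ) * p₀ ^ 2 + 4 * (1 + Φ) * (p₁ ^ 2 + p₂ ^ 2 + p₃ ^ 2) := by ring
  rw [hsplit]
  -- name the atoms `a = l⃗·p⃗`, `b = l⃗·n⃗`, `d = n⃗·p⃗`, `P = |p⃗|²`, `N = |n⃗|²`
  revert hN haP hbN hdNP hP0
  generalize l₁ * p₁ + l₂ * p₂ + l₃ * p₃ = a
  generalize l₁ * n₁ + l₂ * n₂ + l₃ * n₃ = b
  generalize n₁ * p₁ + n₂ * p₂ + n₃ * p₃ = d
  generalize p₁ ^ 2 + p₂ ^ 2 + p₃ ^ 2 = P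
  generalize n₁ ^ 2 + n₂ ^ 2 + n₃ ^ 2 = N
  intro hN haP hbN hdNP hP0
  have hQ0 : 0 ≤ P - a ^ 2 := sub_nonneg.2 haP
  have hb1 : b ^ 2 ≤ 1 := hbN.trans hN
  have hdP : d ^ 2 ≤ P := hdNP.trans (by nlinarith [mul_nonneg (sub_nonneg.2 hN) hP0])
  have hΦ0 : 0 ≤ Φ := hf0.trans hf1
  rw [abs_le]
  constructor
  · nlinarith [sq_nonneg (d - p₀), hdP,
      mul_nonneg (mul_nonneg hf0 (sq_nonneg (1 - b))) (sq_nonneg p₀),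
      mul_nonneg (mul_nonneg hf0 (sub_nonneg.2 hb1)) (sq_nonneg p₀),
      mul_nonneg hf0 (sq_nonneg (a + b * p₀)), mul_nonneg hf0 hQ0,
      mul_nonneg (sub_nonneg.2 hf1) (sq_nonneg p₀), mul_nonneg (sub_nonneg.2 hf1) hP0,
      sq_nonneg p₀, hP0, mul_nonneg hΦ0 hP0, mul_nonneg hΦ0 (sq_nonneg p₀),
      mul_nonneg hf0 (sq_nonneg p₀), mul_nonneg hf0 hP0]
  · nlinarith [sq_nonneg (d + p₀), hdP,
      mul_nonneg (mul_nonneg hf0 (sq_nonneg (1 + b))) (sq_nonneg p₀),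
      mul_nonneg (mul_nonneg hf0 (sub_nonneg.2 hb1)) (sq_nonneg p₀),
      mul_nonneg hf0 (sq_nonneg (a - b * p₀)), mul_nonneg hf0 hQ0, mul_nonneg hf0 (sq_nonneg a),
      mul_nonneg (sub_nonneg.2 hf1) (sq_nonneg p₀), mul_nonneg (sub_nonneg.2 hf1) hP0,
      sq_nonneg p₀, hP0, mul_nonneg hΦ0 hP0, mul_nonneg hΦ0 (sq_nonneg p₀),
      mul_nonneg hf0 (sq_nonneg p₀), mul_nonneg hf0 hP0]

/-! ### Component facts of a normalised null vector -/

/-- A Minkowski-null vector `v` with `η(v, ∂₀) = 1` has `v⁰ = −1` and `|v⃗|² = 1`. [folklore] -/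
theorem tEnergyLeaf_null_normalised_components {v : E4} (hnull : Minkowski.bilin v v = 0)
    (hnorm : Minkowski.bilin v (E4.basisVector 0) = 1) :
    v 0 = -1 ∧ v 1 ^ 2 + v 2 ^ 2 + v 3 ^ 2 = 1 := by
  have h0 : v 0 = -1 := by
    rw [Minkowski.bilin_symm, Minkowski.bilin_basisVector_zero_left] at hnorm
    linarith
  refine ⟨h0, ?_⟩
  simp only [Minkowski.bilin_apply, Fin.sum_univ_three, Fin.isValue, Fin.succ_zero_eq_one,
    Fin.succ_one_eq_two, h0] at hnull
  have h3 : (Fin.succ 2 : Fin 4) = 3 := rfl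
  rw [h3] at hnull
  nlinarith [hnull]

/-- `∑_{i<3} n_{i+1}² = n₁² + n₂² + n₃²` for a covector `n : Fin 4 → ℝ`. [folklore] -/
theorem tEnergyLeaf_sum_sq_succ (n : Fin 4 → ℝ) :
    ∑ i : Fin 3, n i.succ ^ 2 = n 1 ^ 2 + n 2 ^ 2 + n 3 ^ 2 := by
  simp only [Fin.sum_univ_three, Fin.isValue, Fin.succ_zero_eq_one, Fin.succ_one_eq_two]
  rfl

/-! ### The registered stubs -/

/-- **Coercivity of the `T`-energy through a tilted lab leaf, uniformly off the ergoregion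
margin.** For every `φ₀ < 1` there is `c > 0` (namely `(1 − φ₀)/16`) such that for every
Kerr–Schild-form coefficient field `G = η⁻¹ − φ l ⊗ l` (`l` null, `η(l, ∂₀) = 1`), every point with
`0 ≤ φ(x) ≤ φ₀`, every conormal `n = (1, n⃗)` with `|n⃗|² ≤ ¼` (a leaf `{x⁰ = s + F(x⃗)}` of slope
`≤ ½`) and every `w`: `c ∑_μ (∂_μ w)²(x) ≤ −∑_μ (J^T)^μ(x) n_μ`, `T = ∂₀`
(DRSR arXiv:1402.7034, §3.1: `J^N_μ n^μ ∼ ∑ (∂ψ)²`; here by explicit algebra). [folklore] -/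
theorem tEnergy_leafFlux_coercive : ∀ φ₀ : ℝ, φ₀ < 1 → ∃ c : ℝ, 0 < c ∧ ∀ (φ : E4 → ℝ) (l : E4 → E4) (w : E4 → ℝ) (x : E4) (n : Fin 4 → ℝ), 0 ≤ φ x → φ x ≤ φ₀ → Minkowski.bilin (l x) (l x) = 0 → Minkowski.bilin (l x) (E4.basisVector 0) = 1 → n 0 = 1 → ∑ i : Fin 3, n i.succ ^ 2 ≤ 4⁻¹ → c * ∑ μ, fderiv ℝ w x (E4.basisVector μ) ^ 2 ≤ -∑ μ, KerrSchild.multiplierCurrent (KerrSchild.inverseMetric φ l) KerrSchild.timeField w x μ * n μ := by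
  intro φ₀ hφ₀
  refine ⟨(1 - φ₀) / 16, by linarith, ?_⟩
  intro φ l w x n hφ0 hφ1 hnull hnorm hn0 hn
  obtain ⟨hl0, hL⟩ := tEnergyLeaf_null_normalised_components hnull hnorm
  rw [tEnergyLeaf_sum_sq_succ] at hn
  rw [neg_sum_multiplierCurrent_timeField_mul_eq φ l w x n hl0 hn0, Fin.sum_univ_four]
  exact tEnergyLeaf_fluxPoly_coercive _ _ _ _ hφ0 hφ1 hφ₀ hL hn

/-- **Boundedness of the `T`-energy flux through a tilted lab leaf.** For every `Φ ≥ 0` there is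
`C ≥ 0` (namely `4(1 + Φ)`) such that for every Kerr–Schild-form coefficient field
`G = η⁻¹ − φ l ⊗ l` (`l` null, `η(l, ∂₀) = 1`), every point with `0 ≤ φ(x) ≤ Φ`, every conormal
`n = (1, n⃗)` with `|n⃗|² ≤ 1` and every `w`: `|∑_μ (J^T)^μ(x) n_μ| ≤ C ∑_μ (∂_μ w)²(x)`
(the trivial half of `J^N_μ n^μ ∼ ∑ (∂ψ)²`, DRSR arXiv:1402.7034, §3.1). [folklore] -/
theorem abs_sum_multiplierCurrent_timeField_mul_le : ∀ Φ : ℝ, 0 ≤ Φ → ∃ C : ℝ, 0 ≤ C ∧ ∀ (φ : E4 → ℝ) (l : E4 → E4) (w : E4 → ℝ) (x : E4) (n : Fin 4 → ℝ), 0 ≤ φ x → φ x ≤ Φ → Minkowski.bilin (l x) (l x) = 0 → Minkowski.bilin (l x) (E4.basisVector 0) = 1 → n 0 = 1 → ∑ i : Fin 3, n i.succ ^ 2 ≤ 1 → |∑ μ, KerrSchild.multiplierCurrent (KerrSchild.inverseMetric φ l) KerrSchild.timeField w x μ * n μ| ≤ C * ∑ μ, fderiv ℝ w x (E4.basisVector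 μ) ^ 2 := by
  intro Φ hΦ
  refine ⟨4 * (1 + Φ), by positivity, ?_⟩
  intro φ l w x n hφ0 hφ1 hnull hnorm hn0 hn
  obtain ⟨hl0, hL⟩ := tEnergyLeaf_null_normalised_components hnull hnorm
  rw [tEnergyLeaf_sum_sq_succ] at hn
  have h := neg_sum_multiplierCurrent_timeField_mul_eq φ l w x n hl0 hn0
  rw [neg_eq_iff_eq_neg] at h
  rw [h, abs_neg, Fin.sum_univ_four]
  exact tEnergyLeaf_fluxPoly_abs_le _ _ _ _ hφ0 hφ1 hL hn

end Summit.FinalStateConjecture.FinalStateConjecture.Theorems
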